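import Summits.Ventures.PackingBounds.ThreePointCert.T18Proof
import Summits.Ventures.PackingBounds.SphericalCodes.TammesReading
import Summits.Ventures.PackingBounds.Configurations.TammesConfigsA

/-!
# Tammes problem, `N = 18`: `θ(18) < arccos(6389/10000) = 50.290…°` (kernel-checked three-point bound)

Framing: lottery ticket; floor = certified bounds/negative ranges. Venture `PackingBounds`
(cell `pub-packcert`), spherical-codes family, table B2b (Tammes) row `N = 18`.

The kernel-checked Bachoc–Vallentin three-point certificate
`ThreePointCert.T18.tammes18_card_le_17_sdp` (`n = 3`, `s = 6389/10000`, degree 10, Bachoc–Vallentin's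
multiplier set, Chebyshev kernels on `S²`; exact bound value `17.961366 < 18`) says: every finite set of
unit vectors of `ℝ³` with pairwise inner products `≤ 6389/10000` has at most `17` elements. In Tammes form:
among any `18` or more points of `S²` two distinct ones make an angle `< arccos(6389/10000) = 50.290…°`,
so `θ(18) < arccos(6389/10000)`. Print record: no semidefinite-programming bound was printed for `N = 18`; the classical
Fejes Tóth (1943) bound is `51.69°`, every linear-programming-class bound is `≥` the Delsarte optimum
(exact shield value `18.75 ≥ 18` at this `s`, cell file certs/delsarte-shield); best configuration known
`49.5567…°` (`Config.TammesConfigsA`). A certified bound, not a configuration and not an optimality claim.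

## References
* C. Bachoc, F. Vallentin, J. Amer. Math. Soc. 21 (2008), Theorem 4.2. [`BachocVallentin2007`]
* C. Bachoc, F. Vallentin, Semidefinite programming, multivariate orthogonal polynomials, and codes in
  spherical caps, Proc. ISIT 2007, Table 5.3.
-/

noncomputable section

open Finset
open scoped RealInnerProductSpace

namespace Summit.Ventures.PackingBounds.SphericalCodes

/-- **Tammes `N = 18`, inner products**: among any `18` or more unit vectors of `ℝ³`, two distinct ones
have inner product `> 6389/10000`. -/
theorem tammes18_exists_inner_gt (C : Finset (EuclideanSpace ℝ (Fin 3)))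
    (h1 : ∀ x ∈ C, ‖x‖ = 1) (hC : 17 < C.card) :
    ∃ x ∈ C, ∃ y ∈ C, x ≠ y ∧ (6389 / 10000 : ℝ) < inner ℝ x y :=
  exists_inner_gt_of_codeBound ThreePointCert.T18.tammes18_card_le_17_sdp C h1 hC

/-- **Tammes `N = 18`, angles**: among any `18` or more unit vectors of `ℝ³`, two distinct ones make an
(unoriented) angle `< arccos(6389/10000)` (`= 50.290…°`; classical Fejes Tóth bound `51.69°`). -/
theorem tammes18_exists_angle_lt_arccos (C : Finset (EuclideanSpace ℝ (Fin 3)))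
    (h1 : ∀ x ∈ C, ‖x‖ = 1) (hC : 17 < C.card) :
    ∃ x ∈ C, ∃ y ∈ C, x ≠ y ∧ InnerProductGeometry.angle x y < Real.arccos (6389 / 10000) :=
  exists_angle_lt_arccos_of_codeBound ThreePointCert.T18.tammes18_card_le_17_sdp
    (by norm_num) C h1 hC

/-- **`θ(18) < arccos(6389/10000)`**: any common lower bound `θ` for the pairwise angles of `18` or more
unit vectors of `ℝ³` satisfies `θ < arccos(6389/10000)`. -/
theorem tammes18_minAngle_lt_arccos (C : Finset (EuclideanSpace ℝ (Fin 3)))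
    (h1 : ∀ x ∈ C, ‖x‖ = 1) (hC : 17 < C.card) (θ : ℝ)
    (hθ : ∀ x ∈ C, ∀ y ∈ C, x ≠ y → θ ≤ InnerProductGeometry.angle x y) :
    θ < Real.arccos (6389 / 10000) :=
  minAngle_lt_arccos_of_codeBound ThreePointCert.T18.tammes18_card_le_17_sdp
    (by norm_num) C h1 hC θ hθ

/-- **Kernel bracket for the 18-point Tammes problem** (both sides in the tree): there ARE 18 unit vectors of
`ℝ³` with all pairwise inner products `≤ 64869591/10⁸` (`Config.Tammes.exists_code_18`, the best
configuration known, angle `49.5567…°`), and among ANY 18 unit vectors two distinct ones have inner product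
`> 6389/10000` (angle `< 50.290…°`). In Tammes terms: `49.5567…° ≤ θ(18) < 50.2902°`. -/
theorem tammes18_bracket :
    (∃ C : Finset (EuclideanSpace ℝ (Fin 3)), C.card = 18 ∧ (∀ x ∈ C, ‖x‖ = 1) ∧
      ∀ x ∈ C, ∀ y ∈ C, x ≠ y → inner ℝ x y ≤ (64869591 : ℝ) / 100000000) ∧
    ∀ C : Finset (EuclideanSpace ℝ (Fin 3)), (∀ x ∈ C, ‖x‖ = 1) → 17 < C.card →
      ∃ x ∈ C, ∃ y ∈ C, x ≠ y ∧ (6389 / 10000 : ℝ) < inner ℝ x y :=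
  ⟨Config.Tammes.exists_code_18, fun C h1 hC => tammes18_exists_inner_gt C h1 hC⟩

end Summit.Ventures.PackingBounds.SphericalCodes

end
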